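import Mathlib
import Summits.ResolutionOfSingularities.ResolutionOfSingularities.Theorems.WildQuotientsWildQuotientResolutionReesChartTheta
import HarnessLib

/-!
# The twist engine: a Rees chart ring localised at `θ`, read through a twisted root chart `ψ`, is `E[1/Q]`

(crux stmt-ResolutionOfSingularities-15640 `WildQuotients.WildQuotientResolution`, line `Sketch`,
sector `|G| = p`; programme V4U of `L/w45c/CHAIN.md` v6 §4 row stub-2, design of record
`L/w45c/V4U-DESIGN.md` §3/§6 T2 (b), ABSTRACT form; [OURS · L1 W4.5c] — NOT a statement of any
manuscript; replaces the role of no printed item.)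

`exists_ringEquiv_of_twistData`: `I = (g_j) ⊆ R = k[x]`, `T ∈ I`, `H₃ ∈ I²`, `B = (R[It])_{(Tt)}`,
`θ = (H₃t²)/(Tt)²`, `C` any localisation of `B` at `θ`; a twist datum `ψ : R → R` (injective `k`-algebra
map, `ψT = s⁶Q`, `ψH₃ = Q(s⁶Q)²`, `ψg_j = s⁶q_j`, even values, passengers fixed, and an inverse dictionary
for `s², sA, sξ, A², Aξ, ξ², η`; slots `s = x_b`, `A = x_a`, `ξ = x_c`, `η = x_d`, `Q = 1 − 3sA + A²η`)
gives `C ≃+* E_Q = k[s², sA, sξ, A², Aξ, ξ², η, passengers][1/Q] ⊆ R[1/Q]` with `F/1 ↦ ψF`,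
`(g_jt)/(Tt) ↦ q_j/Q`, `θ ↦ Q`. Instance of record (`I₆`, `T'`, `H'³`, stub-1's `twistedChart`):
`JordanFour.exists_chartT_ringEquiv` in `…JordanFourChartT`. The same engine is meant to serve the other
twisted root charts of the R-T programme (other vertices, other radicands).
-/

-- single-problem summit: the doubled namespace component `ResolutionOfSingularities` is forced
set_option linter.dupNamespace false

noncomputable section

open MvPolynomial IsLocalization Polynomial HomogeneousLocalization Literature.AlgebraicGeometry.Resolution

namespace Summit.ResolutionOfSingularities.ResolutionOfSingularities.Theorems.WildQuotientResolution.JordanFour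

section TwistEngine

/-! ### §(b) The engine: a Rees chart ring localised at `θ = (H₃t²)/(Tt)²`, twisted by `ψ` -/

variable (k : Type) [Field k] (n : ℕ) (a b c d : Fin n) {m : ℕ} (g : Fin m → MvPolynomial (Fin n) k)
  (T : MvPolynomial (Fin n) k) (hT : T ∈ Ideal.span (Set.range g)) (H₃ : MvPolynomial (Fin n) k)
  (hH₃ : H₃ ∈ Ideal.span (Set.range g) ^ 2)

local notation3 "Ig" => Ideal.span (Set.range g)
local notation3 "Qp" => (1 - 3 * X b * X a + X a ^ 2 * X d : MvPolynomial (Fin n) k)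
local notation3 "Bg" => HomogeneousLocalization.Away (reesGrading Ig) (reesT T hT)
local notation3 "φg" => reesChartBase (I := Ig) T hT
local notation3 "Egens" => (({X b ^ 2, X b * X a, X b * X c, X a ^ 2, X a * X c, X c ^ 2} :
    Set (MvPolynomial (Fin n) k)) ∪ (fun i : Fin n => (X i : MvPolynomial (Fin n) k)) '' {i | i ≠ a ∧ i ≠ b ∧ i ≠ c})
local notation3 "LQ" => Localization.Away Qp
local notation3 "EQ" => Algebra.adjoin k ((algebraMap (MvPolynomial (Fin n) k) LQ) '' Egens ∪
    {(IsLocalization.Away.invSelf Qp : LQ)})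

local notation3 (prettyPrint := false) "θg" =>
  HomogeneousLocalization.Away.mk (reesGrading Ig) (reesT_mem T hT) 2
    (⟨monomial 2 H₃, reesAlgebra.monomial_mem.mpr hH₃⟩ : reesAlgebra Ig) (monomial_two_mem_reesGrading k n g H₃ hH₃)

-- the bookkeeping of units in three localisations is individually cheap but long
set_option maxHeartbeats 1600000 in
/-- **The twist engine** (V4U-DESIGN §3, abstract form of T2(b)). Let `I = (g₁,…,g_m) ⊆ R = k[x]`, `T ∈ I`,
`H₃ ∈ I²`, `B = (R[It])_{(Tt)}` the Rees chart ring at `T`, `θ = (H₃t²)/(Tt)² ∈ B`, and `C` ANY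
localisation of `B` at `θ`. Let `ψ : R → R` be an injective `k`-algebra map («twist datum») with
`ψ T = s⁶Q`, `ψ H₃ = Q (s⁶Q)²`, `ψ g_j = s⁶ q_j` with the `q_j` and all `ψ xᵢ` in the even subalgebra
`E = k[s², sA, sξ, A², Aξ, ξ², (xᵢ)_{i ∉ {a,b,c}}]`, `ψ xᵢ = xᵢ` off `{a,b,c,d}` (slots `s = x_b`, `A = x_a`,
`ξ = x_c`, `η = x_d`, `Q = 1 − 3sA + A²η`), and suppose each of `s², sA, sξ, A², Aξ, ξ², η` has the form
`ψ(F) Q^{e'} / ((s⁶Q)^μ Q^e)` with `F ∈ I^μ` (the «inverse dictionary»). Then `C ≃+* E_Q = E[1/Q] ⊆ R[1/Q]`,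
the isomorphism carrying `F/1 ↦ ψF`, `(g_jt)/(Tt) ↦ q_j/Q`, `θ ↦ Q`. (Proof: extend `ψ` to an injective
`h₀ : R[1/T] → R[1/(sQ)]`, restrict to the affine blowup algebra `R[I/T] ≅ B`, extend over `θ ↦ Q`, and
identify the image.) [OURS · L1 W4.5c] [folklore] -/
theorem exists_ringEquiv_of_twistData (had : a ≠ d) (hbd : b ≠ d) (hcd : c ≠ d)
    (ψ : MvPolynomial (Fin n) k →ₐ[k] MvPolynomial (Fin n) k) (hψinj : Function.Injective ψ)
    (hψT : ψ T = X b ^ 6 * Qp) (hψH3 : ψ H₃ = Qp * (X b ^ 6 * Qp) ^ 2)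
    (q : Fin m → MvPolynomial (Fin n) k) (hq : ∀ j, ψ (g j) = X b ^ 6 * q j)
    (hqE : ∀ j, q j ∈ Algebra.adjoin k Egens) (hψE : ∀ i, ψ (X i) ∈ Algebra.adjoin k Egens)
    (hψfix : ∀ i, i ≠ a → i ≠ b → i ≠ c → i ≠ d → ψ (X i) = X i)
    (hdict : ∀ t ∈ ({X b ^ 2, X b * X a, X b * X c, X a ^ 2, X a * X c, X c ^ 2, X d} :
        Set (MvPolynomial (Fin n) k)),
      ∃ (μ e e' : ℕ) (F : MvPolynomial (Fin n) k), F ∈ Ig ^ μ ∧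
        ψ F * Qp ^ e' = t * (X b ^ 6 * Qp) ^ μ * Qp ^ e)
    (C : Type) [CommRing C] [Algebra Bg C] [IsLocalization.Away θg C] :
    ∃ e : C ≃+* EQ,
      (∀ F : MvPolynomial (Fin n) k,
        ((e ((algebraMap Bg C : Bg →+* C) (φg F)) : EQ) : LQ) = algebraMap (MvPolynomial (Fin n) k) LQ (ψ F)) ∧
      (∀ j : Fin m,
        ((e ((algebraMap Bg C : Bg →+* C) (HomogeneousLocalization.Away.mk (reesGrading Ig) (reesT_mem T hT) 1
          (reesT (g j) (Ideal.mem_span_range_self (f := g) (x := j))) (reesT_mem_one_smul g j))) :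
            EQ) : LQ) =
          algebraMap (MvPolynomial (Fin n) k) LQ (q j) * IsLocalization.Away.invSelf Qp) ∧
      ((e ((algebraMap Bg C : Bg →+* C) (θg : Bg)) : EQ) : LQ) = algebraMap (MvPolynomial (Fin n) k) LQ Qp := by
  classical
  -- abstract the element `θ` (keeps unification cheap)
  set θ : Bg := θg with hθ
  set E : Subalgebra k (MvPolynomial (Fin n) k) := Algebra.adjoin k Egens with hE
  have hψEall : ∀ F, ψ F ∈ E := map_mem_of_forall_X_mem k n ψ E hψE
  -- non-vanishing
  have hXb : (X b : MvPolynomial (Fin n) k) ≠ 0 := X_ne_zero b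
  have hXa : (X a : MvPolynomial (Fin n) k) ≠ 0 := X_ne_zero a
  have hQ0 : Qp ≠ 0 := by
    intro h
    have h' := congrArg MvPolynomial.constantCoeff h
    simp [MvPolynomial.constantCoeff_X] at h'
  have hXQ0 : (X b * Qp : MvPolynomial (Fin n) k) ≠ 0 := mul_ne_zero hXb hQ0
  have hTp0 : T ≠ 0 := by
    intro h
    have h' : ψ T = 0 := by rw [h, map_zero]
    rw [hψT] at h'
    exact mul_ne_zero (pow_ne_zero 6 hXb) hQ0 h'
  -- the three localisations `k[x][1/T']`, `k[x][1/(sQ)]`, `k[x][1/Q]`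
  set L₁ := Localization.Away T with hL₁
  set ι₁ := algebraMap (MvPolynomial (Fin n) k) L₁ with hι₁
  set L' := Localization.Away (X b * Qp : MvPolynomial (Fin n) k) with hL'
  set ι' := algebraMap (MvPolynomial (Fin n) k) L' with hι'
  set ιQ := algebraMap (MvPolynomial (Fin n) k) LQ with hιQ
  have hι'inj : Function.Injective ι' :=
    IsLocalization.injective L' (M := Submonoid.powers (X b * Qp : MvPolynomial (Fin n) k))
      (Submonoid.powers_le.2 (mem_nonZeroDivisors_of_ne_zero hXQ0))
  have huXQ : IsUnit (ι' (X b * Qp)) := IsLocalization.Away.algebraMap_isUnit _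
  have huX : IsUnit (ι' (X b)) := by
    rw [map_mul] at huXQ; exact isUnit_of_mul_isUnit_left huXQ
  have huQ : IsUnit (ι' Qp) := by
    rw [map_mul] at huXQ; exact isUnit_of_mul_isUnit_right huXQ
  -- `j : k[x][1/Q] → k[x][1/(sQ)]`
  let j : LQ →+* L' := IsLocalization.Away.lift Qp (g := ι') huQ
  have hj : ∀ x, j (ιQ x) = ι' x := fun x => IsLocalization.Away.lift_eq Qp huQ x
  have hjinv : ι' Qp * j (IsLocalization.Away.invSelf Qp) = 1 := by
    have h := congrArg j (IsLocalization.Away.mul_invSelf (S := LQ) Qp)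
    rwa [map_mul, hj, map_one] at h
  have hjinj : Function.Injective j := by
    rw [injective_iff_map_eq_zero]
    intro z hz
    obtain ⟨⟨x, s⟩, hzr⟩ := IsLocalization.surj (Submonoid.powers (Qp)) z
    change z * ιQ s = ιQ x at hzr
    have hx : ι' x = 0 := by rw [← hj, ← hzr, map_mul, hz, zero_mul]
    have hx0 : x = 0 := hι'inj (by rw [hx, map_zero])
    rw [hx0, map_zero] at hzr
    exact (IsLocalization.map_units LQ s).mul_left_eq_zero.mp hzr
  let jₐ : LQ →ₐ[k] L' :=
    { j with
      commutes' := fun t => by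
        change j (algebraMap k LQ t) = algebraMap k L' t
        rw [IsScalarTower.algebraMap_apply k (MvPolynomial (Fin n) k) LQ, hj,
          ← IsScalarTower.algebraMap_apply] }
  have hjₐinj : Function.Injective jₐ := hjinj
  -- `h₀ : k[x][1/T'] → k[x][1/(sQ)]` extending `ψ`
  have hgT : IsUnit ((ι'.comp ψ.toRingHom) T) := by
    change IsUnit (ι' (ψ T))
    rw [hψT, map_mul, map_pow]
    exact (huX.pow 6).mul huQ
  let h₀ : L₁ →+* L' := IsLocalization.Away.lift T hgT
  have hh₀ι : ∀ x, h₀ (ι₁ x) = ι' (ψ x) := fun x => IsLocalization.Away.lift_eq T hgT x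
  have e1 : ι' (X b) ^ 6 * ι' Qp * h₀ (IsLocalization.Away.invSelf T) = 1 := by
    have h1 : h₀ (ι₁ T * IsLocalization.Away.invSelf T) = 1 := by
      rw [IsLocalization.Away.mul_invSelf, map_one]
    rwa [map_mul h₀, hh₀ι, hψT, map_mul ι', map_pow ι'] at h1
  have hh₀inj : Function.Injective h₀ := by
    rw [injective_iff_map_eq_zero]
    intro z hz
    obtain ⟨⟨x, s⟩, hzr⟩ := IsLocalization.surj (Submonoid.powers T) z
    change z * ι₁ s = ι₁ x at hzr
    have hx : ψ x = 0 := by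
      apply hι'inj
      rw [map_zero, ← hh₀ι, ← hzr, map_mul, hz, zero_mul]
    have hx0 : x = 0 := hψinj (by rw [hx, map_zero])
    rw [hx0, map_zero] at hzr
    exact (IsLocalization.map_units L₁ s).mul_left_eq_zero.mp hzr
  -- `Φ₀ : B_T → k[x][1/(sQ)]`
  let Φ₀ : Bg →+* L' := h₀.comp (reesChart T hT)
  have hΦ₀ : ∀ x, Φ₀ x = h₀ (reesChart T hT x) := fun x => rfl
  have hΦ₀inj : Function.Injective Φ₀ := hh₀inj.comp (reesChart_injective T hT)
  have hΦ₀base : ∀ F, Φ₀ (φg F) = ι' (ψ F) := fun F => by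
    rw [hΦ₀, reesChart_reesChartBase, ← hι₁, hh₀ι]
  have hΦ₀θ : Φ₀ θ = ι' Qp := by
    rw [hΦ₀, hθ, reesChart_theta k n g T hT H₃ hH₃, map_mul h₀, ← hι₁, hh₀ι, hψH3, map_pow h₀]
    simp only [map_mul, map_pow]
    calc _ = ι' Qp * (ι' (X b) ^ 6 * ι' Qp * h₀ (IsLocalization.Away.invSelf T)) ^ 2 := by ring
      _ = ι' Qp := by rw [e1, one_pow, mul_one]
  have hΦ₀gen : ∀ j' : Fin m, Φ₀ (HomogeneousLocalization.Away.mk (reesGrading Ig) (reesT_mem T hT) 1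
      (reesT (g j') (Ideal.mem_span_range_self (f := g) (x := j'))) (reesT_mem_one_smul g j')) =
      ι' (q j') * j (IsLocalization.Away.invSelf Qp) := by
    intro j'
    rw [hΦ₀, reesChart_chartGen k n g T hT, map_mul h₀, ← hι₁, hh₀ι, hq j', map_mul ι', map_pow ι']
    linear_combination (ι' (q j') * j (IsLocalization.Away.invSelf Qp)) * e1 -
      (ι' (q j') * ι' (X b) ^ 6 * h₀ (IsLocalization.Away.invSelf T)) * hjinv
  -- `Φ : C → k[x][1/(sQ)]`
  have hθu : IsUnit (Φ₀ θ) := by rw [hΦ₀θ]; exact huQ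
  let Φ : C →+* L' := IsLocalization.Away.lift θ hθu
  have hΦalg : ∀ x, Φ ((algebraMap Bg C : Bg →+* C) x) = Φ₀ x := fun x =>
    IsLocalization.Away.lift_eq θ hθu x
  have hΦinvθ : ι' Qp * Φ (IsLocalization.Away.invSelf θ) = 1 := by
    have h := congrArg Φ (IsLocalization.Away.mul_invSelf (S := C) θ)
    rw [map_mul Φ, map_one Φ] at h
    rw [← hΦ₀θ, ← hΦalg]
    exact h
  have hΦinvθ' : Φ (IsLocalization.Away.invSelf θ) = j (IsLocalization.Away.invSelf Qp) :=
    left_inv_eq_right_inv (by rw [mul_comm]; exact hΦinvθ) hjinv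
  have hΦinj : Function.Injective Φ := by
    rw [injective_iff_map_eq_zero]
    intro z hz
    obtain ⟨⟨x, s⟩, hzr⟩ := IsLocalization.surj (Submonoid.powers θ) z
    change z * (algebraMap Bg C : Bg →+* C) s = (algebraMap Bg C : Bg →+* C) x at hzr
    have hx : Φ₀ x = 0 := by rw [← hΦalg, ← hzr, map_mul Φ, hz, zero_mul]
    have hx0 : x = 0 := hΦ₀inj (by rw [hx, map_zero])
    rw [hx0, map_zero] at hzr
    exact (IsLocalization.map_units C s).mul_left_eq_zero.mp hzr
  -- membership helpers for `E_Q`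
  have hιQE : ∀ x, x ∈ E → ιQ x ∈ EQ := by
    intro x hx
    refine Algebra.adjoin_induction (fun y hy => ?_) (fun t => ?_) (fun _ _ _ _ hx hy => ?_)
      (fun _ _ _ _ hx hy => ?_) hx
    · exact Algebra.subset_adjoin (Set.mem_union_left _ ⟨y, hy, rfl⟩)
    · rw [← IsScalarTower.algebraMap_apply]
      exact Subalgebra.algebraMap_mem _ _
    · rw [map_add ιQ]; exact Subalgebra.add_mem _ hx hy
    · rw [map_mul ιQ]; exact Subalgebra.mul_mem _ hx hy
  have hinvQE : (IsLocalization.Away.invSelf Qp : LQ) ∈ EQ :=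
    Algebra.subset_adjoin (Set.mem_union_right _ rfl)
  have hmapj : ∀ w, w ∈ EQ → j w ∈ Subalgebra.map jₐ EQ := fun w hw => Subalgebra.mem_map.mpr ⟨w, hw, rfl⟩
  -- (⊆) the image of `Φ` lies in `j(E_Q)`
  have hBlsub : ∀ y, y ∈ blowupAlgebra Ig T → h₀ y ∈ Subalgebra.map jₐ EQ := by
    intro y hy
    refine Algebra.adjoin_induction (fun y hy => ?_) (fun x => ?_) (fun _ _ _ _ hx hy => ?_)
      (fun _ _ _ _ hx hy => ?_) hy
    · obtain ⟨x, hx, rfl⟩ := hy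
      refine Submodule.span_induction
        (p := fun x _ => h₀ (ι₁ x * IsLocalization.Away.invSelf T) ∈ Subalgebra.map jₐ EQ)
        ?_ ?_ ?_ ?_ hx
      · rintro _ ⟨j', rfl⟩
        rw [map_mul h₀, hh₀ι, hq j', map_mul ι', map_pow ι']
        have key : ι' (X b) ^ 6 * ι' (q j') * h₀ (IsLocalization.Away.invSelf T) =
            j (ιQ (q j') * IsLocalization.Away.invSelf Qp) := by
          rw [map_mul j, hj]
          linear_combination (ι' (q j') * j (IsLocalization.Away.invSelf Qp)) * e1 -
            (ι' (q j') * ι' (X b) ^ 6 * h₀ (IsLocalization.Away.invSelf T)) * hjinv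
        rw [key]
        exact hmapj _ (Subalgebra.mul_mem _ (hιQE _ (hqE j')) hinvQE)
      · rw [map_zero ι₁, zero_mul, map_zero h₀]
        exact Subalgebra.zero_mem _
      · intro x y _ _ hx hy
        rw [map_add ι₁, add_mul, map_add h₀]
        exact Subalgebra.add_mem _ hx hy
      · intro r x _ hx
        rw [smul_eq_mul, map_mul ι₁, mul_assoc (ι₁ r) (ι₁ x) (IsLocalization.Away.invSelf T), map_mul h₀,
          hh₀ι, ← hj]
        exact Subalgebra.mul_mem _ (hmapj _ (hιQE _ (hψEall r))) hx
    · change h₀ (ι₁ x) ∈ _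
      rw [hh₀ι, ← hj]
      exact hmapj _ (hιQE _ (hψEall x))
    · rw [map_add h₀]; exact Subalgebra.add_mem _ hx hy
    · rw [map_mul h₀]; exact Subalgebra.mul_mem _ hx hy
  have hsub : ∀ z : C, Φ z ∈ Subalgebra.map jₐ EQ := by
    intro z
    obtain ⟨⟨x, s⟩, hzr⟩ := IsLocalization.surj (Submonoid.powers θ) z
    obtain ⟨m, hm⟩ := s.2
    change z * (algebraMap Bg C : Bg →+* C) s = (algebraMap Bg C : Bg →+* C) x at hzr
    have hz : Φ z = Φ₀ x * Φ (IsLocalization.Away.invSelf θ) ^ m := by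
      have h1 := congrArg Φ hzr
      rw [map_mul Φ, hΦalg, hΦalg, ← hm, map_pow Φ₀, hΦ₀θ] at h1
      calc Φ z = Φ z * (ι' Qp * Φ (IsLocalization.Away.invSelf θ)) ^ m := by
            rw [hΦinvθ, one_pow, mul_one]
        _ = Φ z * ι' Qp ^ m * Φ (IsLocalization.Away.invSelf θ) ^ m := by ring
        _ = Φ₀ x * Φ (IsLocalization.Away.invSelf θ) ^ m := by rw [h1]
    rw [hz, hΦinvθ']
    refine Subalgebra.mul_mem _ ?_ (Subalgebra.pow_mem _ (hmapj _ hinvQE) m)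
    have hxBl : reesChart T hT x ∈ blowupAlgebra Ig T := by
      have : reesChart T hT x ∈ Set.range (reesChart T hT) := ⟨x, rfl⟩
      rwa [range_reesChart T hT] at this
    exact hBlsub _ hxBl
  -- elements of `C` from the affine blowup algebra, and their images
  have hcOf : ∀ (y : L₁) (hy : y ∈ blowupAlgebra Ig T),
      Φ ((algebraMap Bg C : Bg →+* C) ((reesChartEquiv T hT).symm ⟨y, hy⟩)) = h₀ y := by
    intro y hy
    rw [hΦalg, hΦ₀, ← coe_reesChartEquiv, RingEquiv.apply_symm_apply]
  have hmemBl : ∀ (μ : ℕ) (F : MvPolynomial (Fin n) k), F ∈ Ig ^ μ →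
      ι₁ F * IsLocalization.Away.invSelf T ^ μ ∈ blowupAlgebra Ig T := fun μ F hF =>
    algebraMap_mul_invSelf_pow_mem_blowupAlgebra T μ hF
  -- the dictionary: `ψ F · Q^{e'} = t (s⁶Q)^μ Q^e` gives `t = Φ (F/T^μ · θ^{e'} · θ^{-e})`
  have hdictC : ∀ (μ e e' : ℕ) (F t : MvPolynomial (Fin n) k) (hF : F ∈ Ig ^ μ),
      ψ F * Qp ^ e' = t * (X b ^ 6 * Qp) ^ μ * Qp ^ e →
      Φ ((algebraMap Bg C : Bg →+* C) ((reesChartEquiv T hT).symm ⟨_, hmemBl μ F hF⟩) *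
        (algebraMap Bg C : Bg →+* C) θ ^ e' * IsLocalization.Away.invSelf θ ^ e) = ι' t := by
    intro μ e e' F t hF hψF
    rw [map_mul Φ, map_mul Φ, map_pow Φ, map_pow Φ, hcOf, map_mul h₀, map_pow h₀, hh₀ι, hΦalg, hΦ₀θ]
    have h1 : ι' (ψ F) * ι' Qp ^ e' = ι' t * (ι' (X b) ^ 6 * ι' Qp) ^ μ * ι' Qp ^ e := by
      have h := congrArg ι' hψF
      simpa only [map_mul, map_pow] using h
    calc _ = (ι' (ψ F) * ι' Qp ^ e') * h₀ (IsLocalization.Away.invSelf T) ^ μ *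
          Φ (IsLocalization.Away.invSelf θ) ^ e := by ring
      _ = ι' t * (ι' (X b) ^ 6 * ι' Qp * h₀ (IsLocalization.Away.invSelf T)) ^ μ *
          (ι' Qp * Φ (IsLocalization.Away.invSelf θ)) ^ e := by rw [h1]; ring
      _ = ι' t := by rw [e1, hΦinvθ, one_pow, one_pow, mul_one, mul_one]
  -- (⊇) every generator of `E_Q` is hit
  have hsup : ∀ w, w ∈ EQ → ∃ z : C, Φ z = j w := by
    intro w hw
    refine Algebra.adjoin_induction (fun y hy => ?_) (fun t => ?_) (fun _ _ _ _ hx hy => ?_)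
      (fun _ _ _ _ hx hy => ?_) hw
    · rcases hy with ⟨x, hx, rfl⟩ | hy
      · rw [hj]
        rcases hx with hx | ⟨i, hi, rfl⟩
        · -- the six quadratic generators: the inverse dictionary
          have hx7 : x ∈ ({X b ^ 2, X b * X a, X b * X c, X a ^ 2, X a * X c, X c ^ 2, X d} :
              Set (MvPolynomial (Fin n) k)) := by
            rcases hx with h | h | h | h | h | h
            · exact Or.inl h
            · exact Or.inr (Or.inl h)
            · exact Or.inr (Or.inr (Or.inl h))
            · exact Or.inr (Or.inr (Or.inr (Or.inl h)))
            · exact Or.inr (Or.inr (Or.inr (Or.inr (Or.inl h))))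
            · exact Or.inr (Or.inr (Or.inr (Or.inr (Or.inr (Or.inl h)))))
          obtain ⟨μ, e, e', F, hF, hψF⟩ := hdict x hx7
          exact ⟨_, hdictC μ e e' F x hF hψF⟩
        · obtain ⟨hia, hib, hic⟩ := hi
          by_cases hid : i = d
          · rw [hid]
            obtain ⟨μ, e, e', F, hF, hψF⟩ :=
              hdict (X d) (Or.inr (Or.inr (Or.inr (Or.inr (Or.inr (Or.inr rfl))))))
            exact ⟨_, hdictC μ e e' F (X d) hF hψF⟩
          · -- passengers are fixed
            exact ⟨(algebraMap Bg C : Bg →+* C) (φg (X i)), by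
              rw [hΦalg, hΦ₀base, hψfix i hia hib hic hid]⟩
      · rw [Set.mem_singleton_iff] at hy
        rw [hy]
        exact ⟨_, hΦinvθ'⟩
    · refine ⟨(algebraMap Bg C : Bg →+* C) (φg (MvPolynomial.C t)), ?_⟩
      rw [hΦalg, hΦ₀base, IsScalarTower.algebraMap_apply k (MvPolynomial (Fin n) k) LQ, hj,
        MvPolynomial.algebraMap_eq, ← MvPolynomial.algebraMap_eq, AlgHom.commutes]
    · obtain ⟨z₁, h₁⟩ := hx
      obtain ⟨z₂, h₂⟩ := hy
      exact ⟨z₁ + z₂, by rw [map_add Φ, h₁, h₂, map_add j]⟩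
    · obtain ⟨z₁, h₁⟩ := hx
      obtain ⟨z₂, h₂⟩ := hy
      exact ⟨z₁ * z₂, by rw [map_mul Φ, h₁, h₂, map_mul j]⟩
  -- the isomorphism `C ≃ E_Q.map jₐ ≃ E_Q`
  let Φ' : C →+* ↥(Subalgebra.map jₐ EQ) := Φ.codRestrict (Subalgebra.map jₐ EQ).toSubring fun z => hsub z
  have hΦ' : Function.Bijective Φ' := by
    refine ⟨fun z₁ z₂ h => hΦinj (congrArg Subtype.val h), fun y => ?_⟩
    obtain ⟨w, hw, hwy⟩ := Subalgebra.mem_map.mp y.2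
    obtain ⟨z, hz⟩ := hsup w hw
    exact ⟨z, Subtype.ext (by rw [← hwy]; exact hz)⟩
  let e₁ : C ≃+* ↥(Subalgebra.map jₐ EQ) := RingEquiv.ofBijective Φ' hΦ'
  let e₂ : ↥(Subalgebra.map jₐ EQ) ≃+* ↥EQ := (Subalgebra.equivMapOfInjective EQ jₐ hjₐinj).symm.toRingEquiv
  have he : ∀ (z : C) (w : LQ) (hw : w ∈ EQ), Φ z = j w → ((e₁.trans e₂ z : EQ) : LQ) = w := by
    intro z w hw hzw
    have hw' : j w ∈ Subalgebra.map jₐ EQ := hmapj w hw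
    have h1 : e₁ z = ⟨j w, hw'⟩ := Subtype.ext hzw
    have h2 : (Subalgebra.equivMapOfInjective EQ jₐ hjₐinj) ⟨w, hw⟩ = ⟨j w, hw'⟩ :=
      Subtype.ext (Subalgebra.coe_equivMapOfInjective_apply EQ jₐ hjₐinj ⟨w, hw⟩)
    have h3 : e₂ ⟨j w, hw'⟩ = ⟨w, hw⟩ := by
      change (Subalgebra.equivMapOfInjective EQ jₐ hjₐinj).symm ⟨j w, hw'⟩ = ⟨w, hw⟩
      rw [AlgEquiv.symm_apply_eq, h2]
    rw [RingEquiv.trans_apply, h1, h3]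
  refine ⟨e₁.trans e₂, fun F => ?_, fun j' => ?_, ?_⟩
  · exact he _ _ (hιQE _ (hψEall F)) (by rw [hΦalg, hΦ₀base, hj])
  · exact he _ _ (Subalgebra.mul_mem _ (hιQE _ (hqE j')) hinvQE) (by rw [hΦalg, hΦ₀gen, map_mul j, hj])
  · have hQE : ιQ Qp ∈ EQ := by
      refine hιQE _ ?_
      have hba : (X b * X a : MvPolynomial (Fin n) k) ∈ E :=
        Algebra.subset_adjoin (Or.inl (by simp))
      have haa : (X a ^ 2 : MvPolynomial (Fin n) k) ∈ E :=
        Algebra.subset_adjoin (Or.inl (by simp))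
      have hd : (X d : MvPolynomial (Fin n) k) ∈ E :=
        Algebra.subset_adjoin (Or.inr ⟨d, ⟨had.symm, hbd.symm, hcd.symm⟩, rfl⟩)
      have h3 : (3 * X b * X a : MvPolynomial (Fin n) k) ∈ E := by
        rw [show (3 * X b * X a : MvPolynomial (Fin n) k) =
            algebraMap k (MvPolynomial (Fin n) k) 3 * (X b * X a) by rw [map_ofNat, mul_assoc]]
        exact Subalgebra.mul_mem _ (Subalgebra.algebraMap_mem _ _) hba
      exact Subalgebra.add_mem _ (Subalgebra.sub_mem _ (Subalgebra.one_mem _) h3)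
        (Subalgebra.mul_mem _ haa hd)
    exact he _ _ hQE (by rw [hΦalg, hΦ₀θ, hj])

end TwistEngine

end Summit.ResolutionOfSingularities.ResolutionOfSingularities.Theorems.WildQuotientResolution.JordanFour

end
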